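import Summits.AtomisticToContinuum.HydrodynamicLimit.Theorems.JParityClosureLocalSecondLawStrainOfCoarseBounds
import Summits.AtomisticToContinuum.HydrodynamicLimit.Theorems.JParityClosureLocalSecondLawPassivityKineticOfIsotropy
import Summits.AtomisticToContinuum.HydrodynamicLimit.Theorems.JParityClosureLocalSecondLawCollisionalWorkIntegrable
import Summits.AtomisticToContinuum.HydrodynamicLimit.Theorems.JParityClosureLocalSecondLawPassivityThermalOfClosure
import Summits.AtomisticToContinuum.HydrodynamicLimit.Theorems.JParityClosureLocalSecondLawInitialLayer
import Summits.AtomisticToContinuum.HydrodynamicLimit.Theorems.JParityClosureLocalSecondLawLedger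
import Summits.AtomisticToContinuum.HydrodynamicLimit.Theorems.ImplosionDichotomyHsEosLowDensity

/-!
# `JParityClosure.LocalSecondLaw` from the entropy ledger: the composition, and the crux modulo named inputs
(stmt-AtomisticToContinuum-13081, line `exact-entropy-ledger-three-passivities`, lead's composition file)

Two theorems concluding the crux `Summit.AtomisticToContinuum.HydrodynamicLimit.Theses.JParityClosure.LocalSecondLaw`
CONDITIONALLY (the item stays open; this file records the kernel-checked reduction in the tree):

* `localSecondLaw_of_passivities : F → P1 → P2 → P3 → LocalSecondLaw` — the line's union bound with the two CLOSED stubs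
  discharged by their landed theorems (`stub_initialLayer`, …InitialLayer.lean; `stub_ledger`, …Ledger.lean) and the EOS band
  taken from the proved route support `HsEosLowDensity` (`Theorems.hsEosLowDensity_proof`).  Here F = the regular-range
  statement (`stub_regularRange`: w.h.p. the orbit is good and the coarse fields keep a density floor/cap and a temperature
  floor on `[0,τ] × 𝕋³`), P1/P2/P3 = the three passivities (`stub_passivityKinetic/Collisional/Thermal`: `P(Regular ∧ Tᵢ < −η) ≤ δ`
  eventually), all four stated verbatim as hypotheses.  Proof: thresholds `σ₀ := min`, `η₁ := η₀/2`, floor `c` from F at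
  `δ/5`, `r₀ := min`, `N₀ := max`; the crux event, rewritten definitionally through `entropyFunctional`, lies in
  `{Euler bdry < particle bdry − η/4} ∪ Regularᶜ ∪ ⋃ᵢ{Regular ∧ Tᵢ < −η/4}` by the pathwise ledger; `measure_union_le`.
* `localSecondLaw_of_inputs : F → Iso → Strain → CollisionalWorkEnskogLaw → Cubic → ThermalStrain → CollisionalHeat →
  LocalSecondLaw` — the same with P1, P2, P3 replaced by their landed reductions `passivityKinetic_of_isotropy`
  (…PassivityKineticOfIsotropy.lean), `passivityCollisional_of_enskog_isotropy` (…CollisionalWorkIntegrable.lean) and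
  `passivityThermal_of_closure` (…PassivityThermalOfClosure.lean).  The seven antecedents are the line's honest residue, each a
  crux-frame in-probability statement about forward local-Gibbs evolutions with named producers on the board:
  F (pre-shock ⟸ fixed-time field LLN on `[0,τ]` + time-equicontinuity of `(m_r, e_r)`, `regularRange_of_fieldLLN_euler`;
  DensityCap stmt-13082, HydroLimitInBand 9133, DiluteSelfConsistency 3091), Iso = `L¹`-isotropy of the coarse kinetic stress at
  rate `r` (OddContactSymmetry 13078 + RateFloor 13080 ⇒ ParityRigidity 13084, KineticEnergyTails 13087), Strain / ThermalStrain =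
  tightness of `r∇u_r`, `r∇θ_r` on the regular event, CollisionalWorkEnskogLaw = EvenStressEnskog 13079 for the weighted marks,
  Cubic = `L¹`-smallness of the coarse kinetic heat current at rate `r` (the weak cubic closure the crux itself implies;
  EnergyCurrentTails 9235 + local Maxwellisation), CollisionalHeat = the even energy-transfer statistic (Enskog value `0`).

References: Disproof/negatives of the crux (`Theorems/LocalSecondLaw/Negative/*`: the `t = 0` LLN and the support condition are
load-bearing — consumed here by B and by the ledger; no positive gap is claimed, cf. `not_localSecondLawGapAt`);
E. Feireisl, A. Novotný, *Singular Limits in Thermodynamics of Viscous Fluids* (2009/2017), §2 (entropy/entropy-flux bookkeeping);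
R. J. Hardy, J. Chem. Phys. 76 (1982) 622 (bond functions).
-/

noncomputable section

namespace Summit.AtomisticToContinuum.HydrodynamicLimit.Theorems.LocalSecondLawLedger

open scoped BigOperators Topology ENNReal InnerProductSpace
open Filter Set MeasureTheory
open Literature.MathematicalPhysics.KineticTheory
open Literature.Analysis.FluidPDE
open Summit.AtomisticToContinuum.HydrodynamicLimit.Theses
open Summit.AtomisticToContinuum.HydrodynamicLimit.Theorems.LocalSecondLawNegative

/-- **`LocalSecondLaw` from the four open passivity/range statements of the ledger line** (B and L discharged by
their landed theorems, EOS band from the proved `HsEosLowDensity`): regular range → kinetic passivity → collisional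
passivity → thermal passivity → the crux, by the pathwise entropy ledger and a union bound. -/
theorem localSecondLaw_of_passivities :
  (∀ η₁ : ℝ, 0 < η₁ → ∀ (a₀ θ₀ : T3 → ℝ) (u₀ : T3 → V3), Continuous a₀ → Continuous θ₀ → Continuous u₀ → (∀ x, 0 < a₀ x) → (∀ x, 0 < θ₀ x) → ∃ σ₀ : ℝ, 0 < σ₀ ∧ ∀ σ : ℝ, 0 < σ → σ < σ₀ → ∀ (T : ℝ) (ρ θ : ℝ → T3 → ℝ) (u : ℝ → T3 → V3), IsHardSphereEulerSolution σ T ρ u θ → ∀ Φ : (N : ℕ) → Flow σ N, TendstoHydroFieldsAt (fun N => localGibbsLaw σ a₀ u₀ θ₀ N (Φ N)) Φ ρ u θ 0 → 0 < T → ∀ τ : ℝ, 0 < τ → ∀ δ : ℝ, 0 < δ → ∃ c : ℝ, 0 < c ∧ ∃ r₀ : ℝ, 0 < r₀ ∧ ∀ r : ℝ, 0 < r → r < r₀ → ∃ N₀ : ℕ, ∀ N : ℕ, N₀ ≤ N → localGibbsLaw σ a₀ u₀ θ₀ N (Φ N) {z | ¬ Regular σ r τ c η₁ (Φ N) z} ≤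 ENNReal.ofReal δ) → (∀ (a₀ θ₀ : T3 → ℝ) (u₀ : T3 → V3), Continuous a₀ → Continuous θ₀ → Continuous u₀ → (∀ x, 0 < a₀ x) → (∀ x, 0 < θ₀ x) → ∃ σ₀ : ℝ, 0 < σ₀ ∧ ∀ σ : ℝ, 0 < σ → σ < σ₀ → ∀ (T : ℝ) (ρ θ : ℝ → T3 → ℝ) (u : ℝ → T3 → V3), IsHardSphereEulerSolution σ T ρ u θ → ∀ Φ : (N : ℕ) → Flow σ N, TendstoHydroFieldsAt (fun N => localGibbsLaw σ a₀ u₀ θ₀ N (Φ N)) Φ ρ u θ 0 → 0 < T → ∀ τ : ℝ, 0 < τ → ∀ φ : ℝ → T3 → ℝ, Literature.Analysis.FunctionSpaces.Torus.IsSmoothSpaceTimeOn Set.univ φ → (∀ s x, 0 ≤ φ s x) → (∃ τ' : ℝ, τ' < τ ∧ ∀ s, τ' ≤ s → ∀ x, φ s x = 0) → ∀ c η₁ : ℝ, 0 < c → ∀ η δ : ℝ, 0 < η → 0 < δ → ∃ r₀ : ℝ, 0 < r₀ ∧ ∀ r : ℝ, 0 < r → r < r₀ → ∃ N₀ : ℕ,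 ∀ N : ℕ, N₀ ≤ N → localGibbsLaw σ a₀ u₀ θ₀ N (Φ N) {z | Regular σ r τ c η₁ (Φ N) z ∧ T₁ σ r τ φ (Φ N) z < -η} ≤ ENNReal.ofReal δ) → (∀ (η₀ : ℝ) (F : ℝ → ℝ), EosBand η₀ F → ∀ η₁ : ℝ, 0 < η₁ → η₁ < η₀ → ∀ (a₀ θ₀ : T3 → ℝ) (u₀ : T3 → V3), Continuous a₀ → Continuous θ₀ → Continuous u₀ → (∀ x, 0 < a₀ x) → (∀ x, 0 < θ₀ x) → ∃ σ₀ : ℝ, 0 < σ₀ ∧ ∀ σ : ℝ, 0 < σ → σ < σ₀ → ∀ (T : ℝ) (ρ θ : ℝ → T3 → ℝ) (u : ℝ → T3 → V3), IsHardSphereEulerSolution σ T ρ u θ → ∀ Φ : (N : ℕ) → Flow σ N, TendstoHydroFieldsAt (fun N => localGibbsLaw σ a₀ u₀ θ₀ N (Φ N)) Φ ρ u θ 0 → 0 < T → ∀ τ : ℝ, 0 < τ → ∀ φ : ℝ → T3 → ℝ, Literature.Analysis.FunctionSpaces.Torus.IsSmoothSpaceTimeOn Set.univ φ → (∀ s x,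 0 ≤ φ s x) → (∃ τ' : ℝ, τ' < τ ∧ ∀ s, τ' ≤ s → ∀ x, φ s x = 0) → ∀ c : ℝ, 0 < c → ∀ η δ : ℝ, 0 < η → 0 < δ → ∃ r₀ : ℝ, 0 < r₀ ∧ ∀ r : ℝ, 0 < r → r < r₀ → ∃ N₀ : ℕ, ∀ N : ℕ, N₀ ≤ N → localGibbsLaw σ a₀ u₀ θ₀ N (Φ N) {z | Regular σ r τ c η₁ (Φ N) z ∧ T₂ σ r τ φ (Φ N) z < -η} ≤ ENNReal.ofReal δ) → (∀ (a₀ θ₀ : T3 → ℝ) (u₀ : T3 → V3), Continuous a₀ → Continuous θ₀ → Continuous u₀ → (∀ x, 0 < a₀ x) → (∀ x, 0 < θ₀ x) → ∃ σ₀ : ℝ, 0 < σ₀ ∧ ∀ σ : ℝ, 0 < σ → σ < σ₀ → ∀ (T : ℝ) (ρ θ : ℝ → T3 → ℝ) (u : ℝ → T3 → V3), IsHardSphereEulerSolution σ T ρ u θ → ∀ Φ : (N : ℕ) → Flow σ N, TendstoHydroFieldsAt (fun N => localGibbsLaw σ a₀ u₀ θ₀ N (Φ N)) Φ ρ u θ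 0 → 0 < T → ∀ τ : ℝ, 0 < τ → ∀ φ : ℝ → T3 → ℝ, Literature.Analysis.FunctionSpaces.Torus.IsSmoothSpaceTimeOn Set.univ φ → (∀ s x, 0 ≤ φ s x) → (∃ τ' : ℝ, τ' < τ ∧ ∀ s, τ' ≤ s → ∀ x, φ s x = 0) → ∀ c η₁ : ℝ, 0 < c → ∀ η δ : ℝ, 0 < η → 0 < δ → ∃ r₀ : ℝ, 0 < r₀ ∧ ∀ r : ℝ, 0 < r → r < r₀ → ∃ N₀ : ℕ, ∀ N : ℕ, N₀ ≤ N → localGibbsLaw σ a₀ u₀ θ₀ N (Φ N) {z | Regular σ r τ c η₁ (Φ N) z ∧ T₃ σ r τ φ (Φ N) z < -η} ≤ ENNReal.ofReal δ) → JParityClosure.LocalSecondLaw := by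
  intro hF hP1 hP2 hP3
  have hEos : JParityClosure.HsEosLowDensity :=
    Summit.AtomisticToContinuum.HydrodynamicLimit.Theorems.hsEosLowDensity_proof
  -- the two CLOSED stubs of the line, as landed tree theorems
  have hB := stub_initialLayer
  have hL := stub_ledger
  obtain ⟨η₀, hη₀, F, hFan, hFeq, -, -, -⟩ := hEos
  have hband : EosBand η₀ F := ⟨hη₀, hFan, hFeq⟩
  have hη₁ : (0 : ℝ) < η₀ / 2 := by positivity
  have hη₁lt : η₀ / 2 < η₀ := by linarith
  intro a₀ θ₀ u₀ ha hθ hu ha0 hθ0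
  obtain ⟨σB, hσB, HB⟩ := hB η₀ F hband a₀ θ₀ u₀ ha hθ hu ha0 hθ0
  obtain ⟨σF, hσF, HF⟩ := hF (η₀ / 2) hη₁ a₀ θ₀ u₀ ha hθ hu ha0 hθ0
  obtain ⟨σ₁, hσ₁, H1⟩ := hP1 a₀ θ₀ u₀ ha hθ hu ha0 hθ0
  obtain ⟨σ₂, hσ₂, H2⟩ := hP2 η₀ F hband (η₀ / 2) hη₁ hη₁lt a₀ θ₀ u₀ ha hθ hu ha0 hθ0
  obtain ⟨σ₃, hσ₃, H3⟩ := hP3 a₀ θ₀ u₀ ha hθ hu ha0 hθ0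
  refine ⟨min (min σB σF) (min σ₁ (min σ₂ σ₃)),
    lt_min (lt_min hσB hσF) (lt_min hσ₁ (lt_min hσ₂ hσ₃)), ?_⟩
  intro σ hσ hσlt T ρ θ u hE Φ h0 hT τ hτ φ hφ hφ0 hsupp η δ hη hδ
  have hσB' : σ < σB := lt_of_lt_of_le hσlt ((min_le_left _ _).trans (min_le_left _ _))
  have hσF' : σ < σF := lt_of_lt_of_le hσlt ((min_le_left _ _).trans (min_le_right _ _))
  have hσ1' : σ < σ₁ := lt_of_lt_of_le hσlt ((min_le_right _ _).trans (min_le_left _ _))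
  have hσ2' : σ < σ₂ :=
    lt_of_lt_of_le hσlt ((min_le_right _ _).trans ((min_le_right _ _).trans (min_le_left _ _)))
  have hσ3' : σ < σ₃ :=
    lt_of_lt_of_le hσlt ((min_le_right _ _).trans ((min_le_right _ _).trans (min_le_right _ _)))
  have hη4 : (0 : ℝ) < η / 4 := by positivity
  have hδ5 : (0 : ℝ) < δ / 5 := by positivity
  -- the floor, chosen before the resolution
  obtain ⟨c, hc, rF, hrF, HF'⟩ := HF σ hσ hσF' T ρ θ u hE Φ h0 hT τ hτ (δ / 5) hδ5
  -- the resolutions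
  obtain ⟨rB, hrB, HB'⟩ := HB σ hσ hσB' T ρ θ u hE Φ h0 hT φ hφ hφ0 (η / 4) (δ / 5) hη4 hδ5
  obtain ⟨r₁, hr₁, H1'⟩ :=
    H1 σ hσ hσ1' T ρ θ u hE Φ h0 hT τ hτ φ hφ hφ0 hsupp c (η₀ / 2) hc (η / 4) (δ / 5) hη4 hδ5
  obtain ⟨r₂, hr₂, H2'⟩ :=
    H2 σ hσ hσ2' T ρ θ u hE Φ h0 hT τ hτ φ hφ hφ0 hsupp c hc (η / 4) (δ / 5) hη4 hδ5
  obtain ⟨r₃, hr₃, H3'⟩ :=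
    H3 σ hσ hσ3' T ρ θ u hE Φ h0 hT τ hτ φ hφ hφ0 hsupp c (η₀ / 2) hc (η / 4) (δ / 5) hη4 hδ5
  refine ⟨min (min rB rF) (min r₁ (min r₂ r₃)),
    lt_min (lt_min hrB hrF) (lt_min hr₁ (lt_min hr₂ hr₃)), ?_⟩
  intro r hr hrlt
  have hrB' : r < rB := lt_of_lt_of_le hrlt ((min_le_left _ _).trans (min_le_left _ _))
  have hrF' : r < rF := lt_of_lt_of_le hrlt ((min_le_left _ _).trans (min_le_right _ _))
  have hr1' : r < r₁ := lt_of_lt_of_le hrlt ((min_le_right _ _).trans (min_le_left _ _))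
  have hr2' : r < r₂ :=
    lt_of_lt_of_le hrlt ((min_le_right _ _).trans ((min_le_right _ _).trans (min_le_left _ _)))
  have hr3' : r < r₃ :=
    lt_of_lt_of_le hrlt ((min_le_right _ _).trans ((min_le_right _ _).trans (min_le_right _ _)))
  obtain ⟨NB, HB''⟩ := HB' r hr hrB'
  obtain ⟨NF, HF''⟩ := HF' r hr hrF'
  obtain ⟨N₁, H1''⟩ := H1' r hr hr1'
  obtain ⟨N₂, H2''⟩ := H2' r hr hr2'
  obtain ⟨N₃, H3''⟩ := H3' r hr hr3'
  refine ⟨max (max NB NF) (max N₁ (max N₂ N₃)), ?_⟩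
  intro N hN
  have hNB : NB ≤ N := ((le_max_left _ _).trans (le_max_left _ _)).trans hN
  have hNF : NF ≤ N := ((le_max_right _ _).trans (le_max_left _ _)).trans hN
  have hN1 : N₁ ≤ N := ((le_max_left _ _).trans (le_max_right _ _)).trans hN
  have hN2 : N₂ ≤ N :=
    (((le_max_left _ _).trans (le_max_right _ _)).trans (le_max_right _ _)).trans hN
  have hN3 : N₃ ≤ N :=
    (((le_max_right _ _).trans (le_max_right _ _)).trans (le_max_right _ _)).trans hN
  -- the five probabilistic inputs at this `N`
  have EB := HB'' N hNB
  have EF := HF'' N hNF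
  have E1 := H1'' N hN1
  have E2 := H2'' N hN2
  have E3 := H3'' N hN3
  -- the deterministic ledger at this `N`
  have hLed : ∀ z : Phase N, Regular σ r τ c (η₀ / 2) (Φ N) z →
      T₁ σ r τ φ (Φ N) z + T₂ σ r τ φ (Φ N) z + T₃ σ r τ φ (Φ N) z ≤
        entropyFunctional σ r τ φ (Φ N) z + bdry σ r (φ 0) (Φ N) z :=
    fun z hz => hL η₀ F hband (η₀ / 2) c σ r τ hη₁lt hc hσ hr hτ φ hφ hφ0 hsupp N (Φ N) z hz
  -- rewrite the crux event through the named functional (definitional)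
  change localGibbsLaw σ a₀ u₀ θ₀ N (Φ N)
      {z | entropyFunctional σ r τ φ (Φ N) z + ∫ x : T3, Hs σ (ρ 0 x) (θ 0 x) * φ 0 x < -η}
    ≤ ENNReal.ofReal δ
  -- event inclusion
  have hsub : {z | entropyFunctional σ r τ φ (Φ N) z + ∫ x : T3, Hs σ (ρ 0 x) (θ 0 x) * φ 0 x < -η} ⊆
      {z | (∫ x : T3, Hs σ (ρ 0 x) (θ 0 x) * φ 0 x) < bdry σ r (φ 0) (Φ N) z - η / 4} ∪
        {z | ¬ Regular σ r τ c (η₀ / 2) (Φ N) z} ∪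
        {z | Regular σ r τ c (η₀ / 2) (Φ N) z ∧ T₁ σ r τ φ (Φ N) z < -(η / 4)} ∪
        {z | Regular σ r τ c (η₀ / 2) (Φ N) z ∧ T₂ σ r τ φ (Φ N) z < -(η / 4)} ∪
        {z | Regular σ r τ c (η₀ / 2) (Φ N) z ∧ T₃ σ r τ φ (Φ N) z < -(η / 4)} := by
    intro z hz
    simp only [Set.mem_setOf_eq] at hz
    by_contra hcon
    simp only [Set.mem_union, Set.mem_setOf_eq, not_or, not_and, not_lt, not_not] at hcon
    obtain ⟨⟨⟨⟨hB0, hReg⟩, h10⟩, h20⟩, h30⟩ := hcon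
    have h1 := h10 hReg
    have h2 := h20 hReg
    have h3 := h30 hReg
    have hL0 := hLed z hReg
    linarith
  calc localGibbsLaw σ a₀ u₀ θ₀ N (Φ N)
        {z | entropyFunctional σ r τ φ (Φ N) z + ∫ x : T3, Hs σ (ρ 0 x) (θ 0 x) * φ 0 x < -η}
      ≤ localGibbsLaw σ a₀ u₀ θ₀ N (Φ N)
          ({z | (∫ x : T3, Hs σ (ρ 0 x) (θ 0 x) * φ 0 x) < bdry σ r (φ 0) (Φ N) z - η / 4} ∪
            {z | ¬ Regular σ r τ c (η₀ / 2) (Φ N) z} ∪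
            {z | Regular σ r τ c (η₀ / 2) (Φ N) z ∧ T₁ σ r τ φ (Φ N) z < -(η / 4)} ∪
            {z | Regular σ r τ c (η₀ / 2) (Φ N) z ∧ T₂ σ r τ φ (Φ N) z < -(η / 4)} ∪
            {z | Regular σ r τ c (η₀ / 2) (Φ N) z ∧ T₃ σ r τ φ (Φ N) z < -(η / 4)}) :=
        measure_mono hsub
    _ ≤ localGibbsLaw σ a₀ u₀ θ₀ N (Φ N)
          ({z | (∫ x : T3, Hs σ (ρ 0 x) (θ 0 x) * φ 0 x) < bdry σ r (φ 0) (Φ N) z - η / 4} ∪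
            {z | ¬ Regular σ r τ c (η₀ / 2) (Φ N) z} ∪
            {z | Regular σ r τ c (η₀ / 2) (Φ N) z ∧ T₁ σ r τ φ (Φ N) z < -(η / 4)} ∪
            {z | Regular σ r τ c (η₀ / 2) (Φ N) z ∧ T₂ σ r τ φ (Φ N) z < -(η / 4)}) +
        localGibbsLaw σ a₀ u₀ θ₀ N (Φ N)
          {z | Regular σ r τ c (η₀ / 2) (Φ N) z ∧ T₃ σ r τ φ (Φ N) z < -(η / 4)} :=
        measure_union_le _ _
    _ ≤ localGibbsLaw σ a₀ u₀ θ₀ N (Φ N)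
          ({z | (∫ x : T3, Hs σ (ρ 0 x) (θ 0 x) * φ 0 x) < bdry σ r (φ 0) (Φ N) z - η / 4} ∪
            {z | ¬ Regular σ r τ c (η₀ / 2) (Φ N) z} ∪
            {z | Regular σ r τ c (η₀ / 2) (Φ N) z ∧ T₁ σ r τ φ (Φ N) z < -(η / 4)}) +
        localGibbsLaw σ a₀ u₀ θ₀ N (Φ N)
          {z | Regular σ r τ c (η₀ / 2) (Φ N) z ∧ T₂ σ r τ φ (Φ N) z < -(η / 4)} +
        localGibbsLaw σ a₀ u₀ θ₀ N (Φ N)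
          {z | Regular σ r τ c (η₀ / 2) (Φ N) z ∧ T₃ σ r τ φ (Φ N) z < -(η / 4)} :=
        add_le_add (measure_union_le _ _) le_rfl
    _ ≤ localGibbsLaw σ a₀ u₀ θ₀ N (Φ N)
          ({z | (∫ x : T3, Hs σ (ρ 0 x) (θ 0 x) * φ 0 x) < bdry σ r (φ 0) (Φ N) z - η / 4} ∪
            {z | ¬ Regular σ r τ c (η₀ / 2) (Φ N) z}) +
        localGibbsLaw σ a₀ u₀ θ₀ N (Φ N)
          {z | Regular σ r τ c (η₀ / 2) (Φ N) z ∧ T₁ σ r τ φ (Φ N) z < -(η / 4)} +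
        localGibbsLaw σ a₀ u₀ θ₀ N (Φ N)
          {z | Regular σ r τ c (η₀ / 2) (Φ N) z ∧ T₂ σ r τ φ (Φ N) z < -(η / 4)} +
        localGibbsLaw σ a₀ u₀ θ₀ N (Φ N)
          {z | Regular σ r τ c (η₀ / 2) (Φ N) z ∧ T₃ σ r τ φ (Φ N) z < -(η / 4)} :=
        add_le_add (add_le_add (measure_union_le _ _) le_rfl) le_rfl
    _ ≤ localGibbsLaw σ a₀ u₀ θ₀ N (Φ N)
          {z | (∫ x : T3, Hs σ (ρ 0 x) (θ 0 x) * φ 0 x) < bdry σ r (φ 0) (Φ N) z - η / 4} +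
        localGibbsLaw σ a₀ u₀ θ₀ N (Φ N) {z | ¬ Regular σ r τ c (η₀ / 2) (Φ N) z} +
        localGibbsLaw σ a₀ u₀ θ₀ N (Φ N)
          {z | Regular σ r τ c (η₀ / 2) (Φ N) z ∧ T₁ σ r τ φ (Φ N) z < -(η / 4)} +
        localGibbsLaw σ a₀ u₀ θ₀ N (Φ N)
          {z | Regular σ r τ c (η₀ / 2) (Φ N) z ∧ T₂ σ r τ φ (Φ N) z < -(η / 4)} +
        localGibbsLaw σ a₀ u₀ θ₀ N (Φ N)
          {z | Regular σ r τ c (η₀ / 2) (Φ N) z ∧ T₃ σ r τ φ (Φ N) z < -(η / 4)} :=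
        add_le_add (add_le_add (add_le_add (measure_union_le _ _) le_rfl) le_rfl) le_rfl
    _ ≤ ENNReal.ofReal (δ / 5) + ENNReal.ofReal (δ / 5) + ENNReal.ofReal (δ / 5) +
          ENNReal.ofReal (δ / 5) + ENNReal.ofReal (δ / 5) :=
        add_le_add (add_le_add (add_le_add (add_le_add EB EF) E1) E2) E3
    _ = ENNReal.ofReal δ := by
        have h2 : (0 : ℝ) ≤ δ / 5 + δ / 5 := by positivity
        have h3 : (0 : ℝ) ≤ δ / 5 + δ / 5 + δ / 5 := by positivity
        have h4 : (0 : ℝ) ≤ δ / 5 + δ / 5 + δ / 5 + δ / 5 := by positivity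
        rw [← ENNReal.ofReal_add hδ5.le hδ5.le, ← ENNReal.ofReal_add h2 hδ5.le,
          ← ENNReal.ofReal_add h3 hδ5.le, ← ENNReal.ofReal_add h4 hδ5.le]
        congr 1
        ring


/-- **The crux modulo its named inputs.**  `LocalSecondLaw` follows from the regular-range statement F and the six
typed closure inputs of the three passivities: `L¹`-isotropy of the coarse kinetic stress at rate `r` (Iso), strain
tightness (Strain), the weighted collisional-work Enskog law (`CollisionalWorkEnskogLaw`), `L¹`-smallness of the coarse
kinetic heat current at rate `r` (Cubic), thermal strain tightness (ThermalStrain) and the collisional heat law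
(CollisionalHeat) — composition of `localSecondLaw_of_passivities` with the landed reductions
`passivityKinetic_of_isotropy`, `passivityCollisional_of_enskog_isotropy`, `passivityThermal_of_closure`. -/
theorem localSecondLaw_of_inputs :
  (∀ η₁ : ℝ, 0 < η₁ → ∀ (a₀ θ₀ : T3 → ℝ) (u₀ : T3 → V3), Continuous a₀ → Continuous θ₀ → Continuous u₀ → (∀ x, 0 < a₀ x) → (∀ x, 0 < θ₀ x) → ∃ σ₀ : ℝ, 0 < σ₀ ∧ ∀ σ : ℝ, 0 < σ → σ < σ₀ → ∀ (T : ℝ) (ρ θ : ℝ → T3 → ℝ) (u : ℝ → T3 → V3), IsHardSphereEulerSolution σ T ρ u θ → ∀ Φ : (N : ℕ) → Flow σ N, TendstoHydroFieldsAt (fun N => localGibbsLaw σ a₀ u₀ θ₀ N (Φ N)) Φ ρ u θ 0 → 0 < T → ∀ τ : ℝ, 0 < τ → ∀ δ : ℝ, 0 < δ → ∃ c : ℝ, 0 < c ∧ ∃ r₀ : ℝ, 0 < r₀ ∧ ∀ r : ℝ, 0 < r → r < r₀ → ∃ N₀ : ℕ, ∀ N : ℕ, N₀ ≤ N → localGibbsLaw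 σ a₀ u₀ θ₀ N (Φ N) {z | ¬ Regular σ r τ c η₁ (Φ N) z} ≤ ENNReal.ofReal δ) → (∀ (a₀ θ₀ : T3 → ℝ) (u₀ : T3 → V3), Continuous a₀ → Continuous θ₀ → Continuous u₀ → (∀ x, 0 < a₀ x) → (∀ x, 0 < θ₀ x) → ∃ σ₀ : ℝ, 0 < σ₀ ∧ ∀ σ : ℝ, 0 < σ → σ < σ₀ → ∀ (T : ℝ) (ρ θ : ℝ → T3 → ℝ) (u : ℝ → T3 → V3), IsHardSphereEulerSolution σ T ρ u θ → ∀ Φ : (N : ℕ) → Flow σ N, TendstoHydroFieldsAt (fun N => localGibbsLaw σ a₀ u₀ θ₀ N (Φ N)) Φ ρ u θ 0 → 0 < T → ∀ τ : ℝ, 0 < τ → ∀ c η₁ : ℝ, 0 < c → ∀ η δ : ℝ, 0 < η → 0 < δ → ∃ r₀ : ℝ, 0 < r₀ ∧ ∀ r : ℝ, 0 < r → r < r₀ → ∃ N₀ : ℕ, ∀ N : ℕ, N₀ ≤ N → localGibbsLaw σ a₀ u₀ θ₀ N (Φ N) {z | Regular σ r τ c η₁ (Φ N) z ∧ η * r <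 ∫ s in Set.Icc (0 : ℝ) τ, ∫ x : T3, ∑ k : Fin 3, ∑ l : Fin 3, |devC r ((Φ N).flow s z) x k l|} ≤ ENNReal.ofReal δ) → (∀ (a₀ θ₀ : T3 → ℝ) (u₀ : T3 → V3), Continuous a₀ → Continuous θ₀ → Continuous u₀ → (∀ x, 0 < a₀ x) → (∀ x, 0 < θ₀ x) → ∃ σ₀ : ℝ, 0 < σ₀ ∧ ∀ σ : ℝ, 0 < σ → σ < σ₀ → ∀ (T : ℝ) (ρ θ : ℝ → T3 → ℝ) (u : ℝ → T3 → V3), IsHardSphereEulerSolution σ T ρ u θ → ∀ Φ : (N : ℕ) → Flow σ N, TendstoHydroFieldsAt (fun N => localGibbsLaw σ a₀ u₀ θ₀ N (Φ N)) Φ ρ u θ 0 → 0 < T → ∀ τ : ℝ, 0 < τ → ∀ c η₁ : ℝ, 0 < c → ∀ δ : ℝ, 0 < δ → ∃ K : ℝ, 0 < K ∧ ∃ r₀ : ℝ, 0 < r₀ ∧ ∀ r : ℝ, 0 < r → r < r₀ → ∃ N₀ : ℕ, ∀ N : ℕ, N₀ ≤ N → localGibbsLaw σ a₀ u₀ θ₀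 N (Φ N) {z | Regular σ r τ c η₁ (Φ N) z ∧ ∃ s ∈ Set.Icc (0 : ℝ) τ, ∃ x : T3, ∃ k l : Fin 3, K < r * |pD k (fun y => uC r ((Φ N).flow s z) y l) x|} ≤ ENNReal.ofReal δ) → CollisionalWorkEnskogLaw → (∀ (a₀ θ₀ : T3 → ℝ) (u₀ : T3 → V3), Continuous a₀ → Continuous θ₀ → Continuous u₀ → (∀ x, 0 < a₀ x) → (∀ x, 0 < θ₀ x) → ∃ σ₀ : ℝ, 0 < σ₀ ∧ ∀ σ : ℝ, 0 < σ → σ < σ₀ → ∀ (T : ℝ) (ρ θ : ℝ → T3 → ℝ) (u : ℝ → T3 → V3), IsHardSphereEulerSolution σ T ρ u θ → ∀ Φ : (N : ℕ) → Flow σ N, TendstoHydroFieldsAt (fun N => localGibbsLaw σ a₀ u₀ θ₀ N (Φ N)) Φ ρ u θ 0 → 0 < T → ∀ τ : ℝ, 0 < τ → ∀ c η₁ : ℝ, 0 < c → ∀ η δ : ℝ, 0 < η → 0 < δ → ∃ r₀ : ℝ, 0 < r₀ ∧ ∀ r : ℝ, 0 < r → r < r₀ → ∃ N₀ : ℕ,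 ∀ N : ℕ, N₀ ≤ N → localGibbsLaw σ a₀ u₀ θ₀ N (Φ N) {z | Regular σ r τ c η₁ (Φ N) z ∧ η * r < ∫ s in Set.Icc (0 : ℝ) τ, ∫ x : T3, ‖qkinC r ((Φ N).flow s z) x‖} ≤ ENNReal.ofReal δ) → (∀ (a₀ θ₀ : T3 → ℝ) (u₀ : T3 → V3), Continuous a₀ → Continuous θ₀ → Continuous u₀ → (∀ x, 0 < a₀ x) → (∀ x, 0 < θ₀ x) → ∃ σ₀ : ℝ, 0 < σ₀ ∧ ∀ σ : ℝ, 0 < σ → σ < σ₀ → ∀ (T : ℝ) (ρ θ : ℝ → T3 → ℝ) (u : ℝ → T3 → V3), IsHardSphereEulerSolution σ T ρ u θ → ∀ Φ : (N : ℕ) → Flow σ N, TendstoHydroFieldsAt (fun N => localGibbsLaw σ a₀ u₀ θ₀ N (Φ N)) Φ ρ u θ 0 → 0 < T → ∀ τ : ℝ, 0 < τ → ∀ c η₁ : ℝ, 0 < c → ∀ δ : ℝ, 0 < δ → ∃ K : ℝ, 0 < K ∧ ∃ r₀ : ℝ, 0 < r₀ ∧ ∀ r : ℝ, 0 < r → r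 < r₀ → ∃ N₀ : ℕ, ∀ N : ℕ, N₀ ≤ N → localGibbsLaw σ a₀ u₀ θ₀ N (Φ N) {z | Regular σ r τ c η₁ (Φ N) z ∧ ∃ s ∈ Set.Icc (0 : ℝ) τ, ∃ x : T3, ∃ k : Fin 3, K < r * |pD k (fun y => thetaC r ((Φ N).flow s z) y) x|} ≤ ENNReal.ofReal δ) → (∀ (a₀ θ₀ : T3 → ℝ) (u₀ : T3 → V3), Continuous a₀ → Continuous θ₀ → Continuous u₀ → (∀ x, 0 < a₀ x) → (∀ x, 0 < θ₀ x) → ∃ σ₀ : ℝ, 0 < σ₀ ∧ ∀ σ : ℝ, 0 < σ → σ < σ₀ → ∀ (T : ℝ) (ρ θ : ℝ → T3 → ℝ) (u : ℝ → T3 → V3), IsHardSphereEulerSolution σ T ρ u θ → ∀ Φ : (N : ℕ) → Flow σ N, TendstoHydroFieldsAt (fun N => localGibbsLaw σ a₀ u₀ θ₀ N (Φ N)) Φ ρ u θ 0 → 0 < T → ∀ τ : ℝ, 0 < τ → ∀ φ : ℝ → T3 → ℝ, Literature.Analysis.FunctionSpaces.Torus.IsSmoothSpaceTimeOn Set.univ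 φ → (∀ s x, 0 ≤ φ s x) → (∃ τ' : ℝ, τ' < τ ∧ ∀ s, τ' ≤ s → ∀ x, φ s x = 0) → ∀ c η₁ : ℝ, 0 < c → ∀ η δ : ℝ, 0 < η → 0 < δ → ∃ r₀ : ℝ, 0 < r₀ ∧ ∀ r : ℝ, 0 < r → r < r₀ → ∃ N₀ : ℕ, ∀ N : ℕ, N₀ ≤ N → localGibbsLaw σ a₀ u₀ θ₀ N (Φ N) {z | Regular σ r τ c η₁ (Φ N) z ∧ η < |T₃coll σ r τ φ (Φ N) z|} ≤ ENNReal.ofReal δ) → JParityClosure.LocalSecondLaw :=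
  fun hF hIso hStr hW hCub hTS hCH =>
    localSecondLaw_of_passivities hF (passivityKinetic_of_isotropy hIso hStr)
      (passivityCollisional_of_enskog_isotropy hW hIso hStr) (passivityThermal_of_closure hCub hTS hCH)

/-- **The crux modulo six named inputs** (Strain and ThermalStrain eliminated): with the coarse density/energy caps at the
doubled radius (`CoarseBounds2r`, an F-type statement; pre-shock a consequence of the fixed-time field LLN on `[0,τ]`,
`coarseBounds_of_fieldLLN_euler`) the strain tightnesses of `localSecondLaw_of_inputs` are theorems
(`strain_of_coarseBounds`, `thermalStrain_of_coarseBounds`, `Theorems/JParityClosureLocalSecondLawStrainOfCoarseBounds.lean`),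
so `LocalSecondLaw` follows from: the regular range F, the radius-`2r` caps, `L¹`-isotropy of the coarse kinetic stress at
rate `r`, the weighted collisional-work Enskog law, `L¹`-smallness of the coarse kinetic heat current at rate `r`, and the
collisional heat law. -/
theorem localSecondLaw_of_sixInputs :
  (∀ η₁ : ℝ, 0 < η₁ → ∀ (a₀ θ₀ : T3 → ℝ) (u₀ : T3 → V3), Continuous a₀ → Continuous θ₀ → Continuous u₀ → (∀ x, 0 < a₀ x) → (∀ x, 0 < θ₀ x) → ∃ σ₀ : ℝ, 0 < σ₀ ∧ ∀ σ : ℝ, 0 < σ → σ < σ₀ → ∀ (T : ℝ) (ρ θ : ℝ → T3 → ℝ) (u : ℝ → T3 → V3), IsHardSphereEulerSolution σ T ρ u θ → ∀ Φ : (N : ℕ) → Flow σ N, TendstoHydroFieldsAt (fun N => localGibbsLaw σ a₀ u₀ θ₀ N (Φ N)) Φ ρ u θ 0 → 0 < T → ∀ τ : ℝ, 0 < τ → ∀ δ : ℝ, 0 < δ → ∃ c : ℝ, 0 < c ∧ ∃ r₀ : ℝ, 0 < r₀ ∧ ∀ r : ℝ, 0 < r → r < r₀ → ∃ N₀ : ℕ,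 ∀ N : ℕ, N₀ ≤ N → localGibbsLaw σ a₀ u₀ θ₀ N (Φ N) {z | ¬ Regular σ r τ c η₁ (Φ N) z} ≤ ENNReal.ofReal δ) → (∀ (a₀ θ₀ : T3 → ℝ) (u₀ : T3 → V3), Continuous a₀ → Continuous θ₀ → Continuous u₀ → (∀ x, 0 < a₀ x) → (∀ x, 0 < θ₀ x) → ∃ σ₀ : ℝ, 0 < σ₀ ∧ ∀ σ : ℝ, 0 < σ → σ < σ₀ → ∀ (T : ℝ) (ρ θ : ℝ → T3 → ℝ) (u : ℝ → T3 → V3), IsHardSphereEulerSolution σ T ρ u θ → ∀ Φ : (N : ℕ) → Flow σ N, TendstoHydroFieldsAt (fun N => localGibbsLaw σ a₀ u₀ θ₀ N (Φ N)) Φ ρ u θ 0 → 0 < T → ∀ τ : ℝ, 0 < τ → ∀ c η₁ : ℝ, 0 < c → ∀ δ : ℝ, 0 < δ → ∃ D : ℝ, 0 < D ∧ ∃ E : ℝ, 0 < E ∧ ∃ r₀ : ℝ, 0 < r₀ ∧ ∀ r : ℝ, 0 < r → r < r₀ → ∃ N₀ : ℕ, ∀ N : ℕ, N₀ ≤ N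 → localGibbsLaw σ a₀ u₀ θ₀ N (Φ N) {z | Regular σ r τ c η₁ (Φ N) z ∧ ∃ s ∈ Set.Icc (0 : ℝ) τ, ∃ x : T3, D < rhoC (2 * r) ((Φ N).flow s z) x ∨ E < kinC (2 * r) ((Φ N).flow s z) x} ≤ ENNReal.ofReal δ) → (∀ (a₀ θ₀ : T3 → ℝ) (u₀ : T3 → V3), Continuous a₀ → Continuous θ₀ → Continuous u₀ → (∀ x, 0 < a₀ x) → (∀ x, 0 < θ₀ x) → ∃ σ₀ : ℝ, 0 < σ₀ ∧ ∀ σ : ℝ, 0 < σ → σ < σ₀ → ∀ (T : ℝ) (ρ θ : ℝ → T3 → ℝ) (u : ℝ → T3 → V3), IsHardSphereEulerSolution σ T ρ u θ → ∀ Φ : (N : ℕ) → Flow σ N, TendstoHydroFieldsAt (fun N => localGibbsLaw σ a₀ u₀ θ₀ N (Φ N)) Φ ρ u θ 0 → 0 < T → ∀ τ : ℝ, 0 < τ → ∀ c η₁ : ℝ, 0 < c → ∀ η δ : ℝ, 0 < η → 0 < δ → ∃ r₀ : ℝ, 0 < r₀ ∧ ∀ r : ℝ, 0 < r → r < r₀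 → ∃ N₀ : ℕ, ∀ N : ℕ, N₀ ≤ N → localGibbsLaw σ a₀ u₀ θ₀ N (Φ N) {z | Regular σ r τ c η₁ (Φ N) z ∧ η * r < ∫ s in Set.Icc (0 : ℝ) τ, ∫ x : T3, ∑ k : Fin 3, ∑ l : Fin 3, |devC r ((Φ N).flow s z) x k l|} ≤ ENNReal.ofReal δ) → CollisionalWorkEnskogLaw → (∀ (a₀ θ₀ : T3 → ℝ) (u₀ : T3 → V3), Continuous a₀ → Continuous θ₀ → Continuous u₀ → (∀ x, 0 < a₀ x) → (∀ x, 0 < θ₀ x) → ∃ σ₀ : ℝ, 0 < σ₀ ∧ ∀ σ : ℝ, 0 < σ → σ < σ₀ → ∀ (T : ℝ) (ρ θ : ℝ → T3 → ℝ) (u : ℝ → T3 → V3), IsHardSphereEulerSolution σ T ρ u θ → ∀ Φ : (N : ℕ) → Flow σ N, TendstoHydroFieldsAt (fun N => localGibbsLaw σ a₀ u₀ θ₀ N (Φ N)) Φ ρ u θ 0 → 0 < T → ∀ τ : ℝ, 0 < τ → ∀ c η₁ : ℝ, 0 < c → ∀ η δ : ℝ, 0 < η → 0 < δ → ∃ r₀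 : ℝ, 0 < r₀ ∧ ∀ r : ℝ, 0 < r → r < r₀ → ∃ N₀ : ℕ, ∀ N : ℕ, N₀ ≤ N → localGibbsLaw σ a₀ u₀ θ₀ N (Φ N) {z | Regular σ r τ c η₁ (Φ N) z ∧ η * r < ∫ s in Set.Icc (0 : ℝ) τ, ∫ x : T3, ‖qkinC r ((Φ N).flow s z) x‖} ≤ ENNReal.ofReal δ) → (∀ (a₀ θ₀ : T3 → ℝ) (u₀ : T3 → V3), Continuous a₀ → Continuous θ₀ → Continuous u₀ → (∀ x, 0 < a₀ x) → (∀ x, 0 < θ₀ x) → ∃ σ₀ : ℝ, 0 < σ₀ ∧ ∀ σ : ℝ, 0 < σ → σ < σ₀ → ∀ (T : ℝ) (ρ θ : ℝ → T3 → ℝ) (u : ℝ → T3 → V3), IsHardSphereEulerSolution σ T ρ u θ → ∀ Φ : (N : ℕ) → Flow σ N, TendstoHydroFieldsAt (fun N => localGibbsLaw σ a₀ u₀ θ₀ N (Φ N)) Φ ρ u θ 0 → 0 < T → ∀ τ : ℝ, 0 < τ → ∀ φ : ℝ → T3 → ℝ, Literature.Analysis.FunctionSpaces.Torus.IsSmoothSpaceTimeOn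 Set.univ φ → (∀ s x, 0 ≤ φ s x) → (∃ τ' : ℝ, τ' < τ ∧ ∀ s, τ' ≤ s → ∀ x, φ s x = 0) → ∀ c η₁ : ℝ, 0 < c → ∀ η δ : ℝ, 0 < η → 0 < δ → ∃ r₀ : ℝ, 0 < r₀ ∧ ∀ r : ℝ, 0 < r → r < r₀ → ∃ N₀ : ℕ, ∀ N : ℕ, N₀ ≤ N → localGibbsLaw σ a₀ u₀ θ₀ N (Φ N) {z | Regular σ r τ c η₁ (Φ N) z ∧ η < |T₃coll σ r τ φ (Φ N) z|} ≤ ENNReal.ofReal δ) → JParityClosure.LocalSecondLaw :=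
  fun hF hCB hIso hW hCub hCH =>
    localSecondLaw_of_inputs hF hIso (strain_of_coarseBounds hCB) hW hCub (thermalStrain_of_coarseBounds hCB) hCH

end Summit.AtomisticToContinuum.HydrodynamicLimit.Theorems.LocalSecondLawLedger

end
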